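import Literature.NumberTheory.EllipticCurves.IsogenyHomProofs
import Literature.NumberTheory.GaloisRepresentations.AbsGaloisGroupProofs
import HarnessLib

/-!
# Extension of the ground field of an isogeny: `E ∼_K E' ⟹ E_L ∼_L E'_L`

Topic `NumberTheory/EllipticCurves`; companion of the prelude
`Literature.NumberTheory.EllipticCurves.Isogeny` (`WeierstrassCurve.Isogeny`,
`WeierstrassCurve.IsIsogenous`). Standard API, no named fact introduced, nothing asserted beyond
what is proved.

An isogeny in the tree is recorded on GEOMETRIC points: `φ : Isogeny W W'` is a group homomorphism
`E(K̄) → E'(K̄)`, `K̄ = AlgebraicClosure K`, given by a rational map off a finite set and commuting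
with `Γ_K = Gal(K̄/K)` ("defined over `K`", Silverman, *AEC*, III.§4 with I.§3 / Ex. 1.12). For an
ALGEBRAIC extension `L/K` the base-changed curves `E_L = W.baseChange L`, `E'_L` carry the model
`L̄ = AlgebraicClosure L` of the algebraic closure, and `(E_L)(L̄) = E(L̄)` definitionally (Mathlib's
tower algebra structure on `AlgebraicClosure L`). Along any `K`-isomorphism `ι : K̄ ≃ₐ[K] L̄`
(uniqueness of the algebraic closure, Milne, *Fields and Galois Theory*, §7; the tree's
`Literature.NumberTheory.GaloisRepresentations.absClosureEquiv K L`) the map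
`ι_* ∘ φ ∘ ι_*⁻¹ : E_L(L̄) → E'_L(L̄)` is again an isogeny, now over `L`: it is given by the
conjugate rational map `(P₁^ι/Q₁^ι, P₂^ι/Q₂^ι)` off the image of the exceptional set, and it
commutes with `Γ_L` because `ι⁻¹ ∘ σ|_{K} ∘ ι ∈ Γ_K` for `σ ∈ Γ_L`. This is the (tautological in
the language of schemes) statement "an isogeny defined over `K` is defined over every extension
`L ⊇ K`" (Silverman, *AEC*, III.§4, p. 66: isogenies are morphisms over `K̄`; "defined over `K`"
means fixed by `G_{K̄/K}`, I.§3 and Ex. 1.12(c); a fortiori fixed by the subgroup `G_{K̄/L}`).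

## Main statements

* `WeierstrassCurve.geomPointsExtend W L ι : E(K̄) ≃+ E_L(L̄)` — base change of points along `ι`,
  `Γ`-equivariant for the compatible pair `σ ↦ ι⁻¹ σ|_K ι` (`geomPointsExtend_smul`).
* `WeierstrassCurve.isAlgebraicOn_congr_of_algEquiv` — algebraicity is transported along `ι`.
* `WeierstrassCurve.Isogeny.extendScalarsOfAlgEquiv ι φ : Isogeny (W.baseChange L) (W'.baseChange L)`,
  with `extendScalarsOfAlgEquiv_apply_geomPointsExtend` (`φ_L (ι_* P) = ι_* (φ P)`) and
  `degree_extendScalarsOfAlgEquiv` (same degree); `Isogeny.extendScalars L φ` along the tree's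
  chosen `absClosureEquiv K L`.
* `WeierstrassCurve.IsIsogenous.extendScalars` — **`W ∼_K W' ⟹ W_L ∼_L W'_L`** for `L/K` algebraic
  (e.g. a finite extension of number fields).

## References

* [SilvermanAEC2009] J. H. Silverman, *The Arithmetic of Elliptic Curves*, 2nd ed., GTM 106
  (2009): I.§3 (rational maps defined over `K`, Ex. 1.12), II.2.1, III.§4 (isogenies; p. 66).
* J. S. Milne, *Fields and Galois Theory*, §7 (uniqueness of the algebraic closure up to
  `K`-isomorphism). [folklore]

## Design

`noncomputable section`, `open scoped Classical`, one universe `u` (`K L : Type u`, as in the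
prelude: `geomPoints W : Type u`). The transport lemma follows the pattern of the tree's
`WeierstrassCurve.isAlgebraicOn_conj` (`IsogenyGeomEndRingCommProofs`, the case `L = K̄`) and
`isAlgebraicOn_conj_symm_of_algEquiv` (`IsogenyHasCMBaseChangeProofs`, endomorphisms, opposite
direction); here two curves and the direction `K̄ → L̄`. The `Γ_L`-action on `E_L(L̄)` is
"apply `σ` to the coordinates" (`WeierstrassCurve.geomPoints.instDistribMulActionAbsoluteGaloisGroup`
for the curve `W.baseChange L` over `L`), which on the defeq type `(W.baseChange L̄).Point` is
`Affine.Point.map (σ.restrictScalars K)` (definitionally, by cases on points). Rewriting lemmas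
about `Affine.Point.map` are applied after a `change` to Mathlib's point type (the synonym
`geomPoints` carries its group structure by `inferInstanceAs`). Plumbing lemmas are `private`. All curve-specific declarations are deliberate dot-notation extensions in
`namespace WeierstrassCurve`.
-/

noncomputable section

open scoped Classical

universe u

namespace WeierstrassCurve

open Literature.NumberTheory.GaloisRepresentations

variable {K : Type u} [Field K] (W W' : WeierstrassCurve K) (L : Type u) [Field L] [Algebra K L]

/-! ## Base change of geometric points along `ι : K̄ ≃ₐ[K] L̄` -/

/-- The map on points `E(K̄) → E_L(L̄)` along `ι : K̄ ≃ₐ[K] L̄`, `(x, y) ↦ (ι x, ι y)` (Mathlib's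
`Affine.Point.map ι`; `E_L(L̄) = (W.baseChange L).geomPoints` is definitionally the group of points
of `W` over `L̄`). Silverman, *AEC*, III.§2. [folklore] -/
def geomPointsExtendHom (ι : AlgebraicClosure K ≃ₐ[K] AlgebraicClosure L) :
    W.geomPoints →+ (W.baseChange L).geomPoints :=
  Affine.Point.map (W' := W) (ι : AlgebraicClosure K →ₐ[K] AlgebraicClosure L)

/-- The map on points `E_L(L̄) → E(K̄)` along `ι⁻¹ : L̄ → K̄`. Silverman, *AEC*, III.§2. [folklore] -/
def geomPointsExtendInv (ι : AlgebraicClosure K ≃ₐ[K] AlgebraicClosure L) :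
    (W.baseChange L).geomPoints →+ W.geomPoints :=
  Affine.Point.map (W' := W) (ι.symm : AlgebraicClosure L →ₐ[K] AlgebraicClosure K)

variable {W L} in
/-- `ι⁻¹_* (ι_* P) = P`. [folklore] -/
private theorem geomPointsExtendInv_geomPointsExtendHom (ι : AlgebraicClosure K ≃ₐ[K] AlgebraicClosure L)
    (P : W.geomPoints) : W.geomPointsExtendInv L ι (W.geomPointsExtendHom L ι P) = P := by
  rcases P with _ | ⟨x, y, h⟩
  · rfl
  · change Affine.Point.map (W' := W) (ι.symm : AlgebraicClosure L →ₐ[K] AlgebraicClosure K)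
        (Affine.Point.map (W' := W) (ι : AlgebraicClosure K →ₐ[K] AlgebraicClosure L)
          (Affine.Point.some x y h)) = Affine.Point.some x y h
    rw [Affine.Point.map_some, Affine.Point.map_some]
    exact Affine.Point.some.congr_simp _ _ (ι.symm_apply_apply x) _ _ (ι.symm_apply_apply y) _

variable {W L} in
/-- `ι_* (ι⁻¹_* Q) = Q`. [folklore] -/
private theorem geomPointsExtendHom_geomPointsExtendInv (ι : AlgebraicClosure K ≃ₐ[K] AlgebraicClosure L)
    (Q : (W.baseChange L).geomPoints) : W.geomPointsExtendHom L ι (W.geomPointsExtendInv L ι Q) = Q := by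
  rcases Q with _ | ⟨x, y, h⟩
  · rfl
  · change Affine.Point.map (W' := W) (ι : AlgebraicClosure K →ₐ[K] AlgebraicClosure L)
        (Affine.Point.map (W' := W) (ι.symm : AlgebraicClosure L →ₐ[K] AlgebraicClosure K)
          (Affine.Point.some x y h)) = Affine.Point.some x y h
    rw [Affine.Point.map_some, Affine.Point.map_some]
    exact Affine.Point.some.congr_simp _ _ (ι.apply_symm_apply x) _ _ (ι.apply_symm_apply y) _

/-- **Base change of geometric points along a `K`-isomorphism of algebraic closures.** For
`ι : K̄ ≃ₐ[K] L̄` the map `(x, y) ↦ (ι x, ι y)` (Mathlib's `Affine.Point.map ι`) is an additive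
isomorphism `E(K̄) ≃+ E_L(L̄)` with inverse `Affine.Point.map ι⁻¹`; here `E_L(L̄) =
(W.baseChange L).geomPoints` is definitionally the group of points of `W` over `L̄`.
Silverman, *AEC*, III.§2 (points under base extension); Milne, *Fields and Galois Theory*, §7.
[folklore] -/
def geomPointsExtend (ι : AlgebraicClosure K ≃ₐ[K] AlgebraicClosure L) :
    W.geomPoints ≃+ (W.baseChange L).geomPoints where
  toFun := W.geomPointsExtendHom L ι
  invFun := W.geomPointsExtendInv L ι
  left_inv := geomPointsExtendInv_geomPointsExtendHom ι
  right_inv := geomPointsExtendHom_geomPointsExtendInv ι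
  map_add' := (W.geomPointsExtendHom L ι).map_add

variable {W L} in
/-- **Equivariance of `geomPointsExtend`**: for `σ ∈ Γ_L` put `τ = ι⁻¹ ∘ σ|_K ∘ ι ∈ Γ_K`; then
`ι_* (τ • P) = σ • ι_* P`. (The pair `(σ ↦ τ, ι_*)` is a compatible pair in the sense of Serre,
*Galois Cohomology*, I.§2.4; Silverman, *AEC*, VIII.§1.)
[cite: SerreGaloisCohomology1997, I.§2.4 (compatible pairs)] -/
theorem geomPointsExtend_smul (ι : AlgebraicClosure K ≃ₐ[K] AlgebraicClosure L)
    (σ : Field.absoluteGaloisGroup L) (P : W.geomPoints) :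
    W.geomPointsExtend L ι
        ((Field.absoluteGaloisGroup.toAlgEquiv K).symm
          (ι.trans ((AlgEquiv.restrictScalars K
            (Field.absoluteGaloisGroup.toAlgEquiv L σ :
              AlgebraicClosure L ≃ₐ[L] AlgebraicClosure L)).trans ι.symm)) • P) =
      σ • W.geomPointsExtend L ι P := by
  set σK : AlgebraicClosure L ≃ₐ[K] AlgebraicClosure L := AlgEquiv.restrictScalars K
    (Field.absoluteGaloisGroup.toAlgEquiv L σ : AlgebraicClosure L ≃ₐ[L] AlgebraicClosure L)
  set τ : AlgebraicClosure K ≃ₐ[K] AlgebraicClosure K := ι.trans (σK.trans ι.symm)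
  rcases P with _ | ⟨x, y, h⟩
  · rfl
  · change Affine.Point.map (W' := W) (ι : AlgebraicClosure K →ₐ[K] AlgebraicClosure L)
        (Affine.Point.map (W' := W) (τ : AlgebraicClosure K →ₐ[K] AlgebraicClosure K)
          (Affine.Point.some x y h)) =
      Affine.Point.map (W' := W) (σK : AlgebraicClosure L →ₐ[K] AlgebraicClosure L)
        (Affine.Point.map (W' := W) (ι : AlgebraicClosure K →ₐ[K] AlgebraicClosure L)
          (Affine.Point.some x y h))
    have hx : ∀ z : AlgebraicClosure K, (ι : AlgebraicClosure K →ₐ[K] AlgebraicClosure L)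
        ((τ : AlgebraicClosure K →ₐ[K] AlgebraicClosure K) z) =
        (σK : AlgebraicClosure L →ₐ[K] AlgebraicClosure L)
          ((ι : AlgebraicClosure K →ₐ[K] AlgebraicClosure L) z) := fun z ↦
      ι.apply_symm_apply _
    rw [Affine.Point.map_some, Affine.Point.map_some, Affine.Point.map_some, Affine.Point.map_some]
    exact Affine.Point.some.congr_simp _ _ (hx x) _ _ (hx y) _

/-! ## Transport of algebraicity along `ι` -/

/-- Evaluation of a two-variable polynomial commutes with a ring homomorphism applied to the
coefficients and to the arguments. [folklore] -/
private theorem eval_fin_two_map_ringHom {A B : Type*} [CommRing A] [CommRing B] (φ : A →+* B)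
    (p : MvPolynomial (Fin 2) A) (x y : A) :
    MvPolynomial.eval ![φ x, φ y] (MvPolynomial.map φ p) = φ (MvPolynomial.eval ![x, y] p) := by
  rw [MvPolynomial.eval_map,
    show MvPolynomial.eval ![x, y] p = MvPolynomial.eval₂ (RingHom.id _) ![x, y] p from rfl,
    MvPolynomial.eval₂_comp_left, RingHom.comp_id]
  congr 1
  funext i
  fin_cases i <;> rfl

variable {W W' L} in
/-- **An algebraic additive map `E(K̄) → E'(K̄)`, transported along `K̄ ≃ L̄`, is algebraic.** Let
`ι : K̄ ≃ₐ[K] L̄`, and let `β : E(K̄) ≃+ E_L(L̄)`, `β' : E'(K̄) ≃+ E'_L(L̄)` be additive isomorphisms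
that are `Affine.Point.map ι` on points. If `f : E(K̄) →+ E'(K̄)` agrees off a finite set with the
rational map `(P₁/Q₁, P₂/Q₂)`, `Pᵢ, Qᵢ ∈ K̄[x, y]`, then `β' ∘ f ∘ β⁻¹` agrees off the (finite)
image of that set with `(P₁^ι/Q₁^ι, P₂^ι/Q₂^ι)` — the conjugate rational map `φ^ι` of Silverman,
*AEC*, I.§3 (Remark before Ex. 1.12: `φ^σ`, `φ(P)^σ = φ^σ(P^σ)`), read for a field isomorphism
`ι : K̄ ≃ L̄` in place of `σ ∈ G_{K̄/K}`. [cite: SilvermanAEC2009, I.§3 Ex. 1.12 (with the Remark on `φ^σ`)] -/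
theorem isAlgebraicOn_congr_of_algEquiv (ι : AlgebraicClosure K ≃ₐ[K] AlgebraicClosure L)
    (β : W.geomPoints ≃+ (W.baseChange L).geomPoints)
    (hβ : ∀ P, β P = Affine.Point.map (W' := W)
      (ι : AlgebraicClosure K →ₐ[K] AlgebraicClosure L) P)
    (β' : W'.geomPoints ≃+ (W'.baseChange L).geomPoints)
    (hβ' : ∀ P, β' P = Affine.Point.map (W' := W')
      (ι : AlgebraicClosure K →ₐ[K] AlgebraicClosure L) P)
    {f : W.geomPoints →+ W'.geomPoints} (hf : IsAlgebraicOn W W' f) :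
    IsAlgebraicOn (W.baseChange L) (W'.baseChange L)
      ((β'.toAddMonoidHom.comp f).comp β.symm.toAddMonoidHom) := by
  set φ : AlgebraicClosure K →+* AlgebraicClosure L :=
    (ι : AlgebraicClosure K →+* AlgebraicClosure L)
  have hφx : ∀ x, φ x = ι x := fun _ ↦ rfl
  have hιinj : Function.Injective (ι : AlgebraicClosure K →ₐ[K] AlgebraicClosure L) :=
    ι.injective
  -- evaluation at `(ι x, ι y)` of `q^ι` is `ι` of the evaluation of `q` at `(x, y)`
  have heval : ∀ (q : MvPolynomial (Fin 2) (AlgebraicClosure K)) (x y : AlgebraicClosure K),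
      MvPolynomial.eval ![ι x, ι y] (q.map φ) = ι (MvPolynomial.eval ![x, y] q) := fun q x y ↦ by
    rw [← hφx x, ← hφx y]
    exact eval_fin_two_map_ringHom φ q x y
  obtain ⟨P₁, Q₁, P₂, Q₂, hfin⟩ := hf
  refine ⟨P₁.map φ, Q₁.map φ, P₂.map φ, Q₂.map φ, ?_⟩
  refine (hfin.image β).subset fun Q hQ ↦ ?_
  obtain ⟨P, rfl⟩ := β.surjective Q
  refine ⟨P, fun hP ↦ hQ ?_, rfl⟩
  -- transport the agreement of `f` at `P` to `β P`
  obtain ⟨x, y, h, rfl, hQ₁, hQ₂, h', hfP⟩ := hP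
  have hx' : MvPolynomial.eval ![ι x, ι y] (P₁.map φ) / MvPolynomial.eval ![ι x, ι y] (Q₁.map φ) =
      ι (MvPolynomial.eval ![x, y] P₁ / MvPolynomial.eval ![x, y] Q₁) := by
    rw [heval, heval, map_div₀]
  have hy' : MvPolynomial.eval ![ι x, ι y] (P₂.map φ) / MvPolynomial.eval ![ι x, ι y] (Q₂.map φ) =
      ι (MvPolynomial.eval ![x, y] P₂ / MvPolynomial.eval ![x, y] Q₂) := by
    rw [heval, heval, map_div₀]
  have hβP : β (.some x y h) = .some (ι x) (ι y)
      ((Affine.baseChange_nonsingular (W := W)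
        (f := (ι : AlgebraicClosure K →ₐ[K] AlgebraicClosure L)) hιinj x y).mpr h) := by
    rw [hβ]; rfl
  refine ⟨_, _, _, hβP, ?_, ?_, ?_⟩
  · rw [heval]; exact (_root_.map_ne_zero ι).mpr hQ₁
  · rw [heval]; exact (_root_.map_ne_zero ι).mpr hQ₂
  · refine ⟨?_, ?_⟩
    · rw [hx', hy']
      exact (Affine.baseChange_nonsingular (W := W')
        (f := (ι : AlgebraicClosure K →ₐ[K] AlgebraicClosure L)) hιinj _ _).mpr h'
    · rw [AddMonoidHom.comp_apply, AddMonoidHom.comp_apply, AddEquiv.coe_toAddMonoidHom,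
        AddEquiv.coe_toAddMonoidHom, AddEquiv.symm_apply_apply, hfP, hβ', Affine.Point.map_some]
      exact Affine.Point.some.congr_simp _ _ hx'.symm _ _ hy'.symm _

/-! ## The isogeny over `L` -/

namespace Isogeny

variable {W W' L}

/-- **Extension of the ground field of an isogeny along `ι : K̄ ≃ₐ[K] L̄`.** For an isogeny
`φ : E → E'` over `K` and an extension `L/K` with a `K`-isomorphism `ι` of algebraic closures, the
map `ι_* ∘ φ ∘ ι_*⁻¹ : E_L(L̄) → E'_L(L̄)` is an isogeny `E_L → E'_L` over `L`: algebraic by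
`isAlgebraicOn_congr_of_algEquiv` (the conjugate rational map), `Γ_L`-equivariant because
`ι⁻¹ σ|_K ι ∈ Γ_K` commutes with `φ` (`geomPointsExtend_smul`), of finite kernel because algebraic
(`IsAlgebraicOn.finite_ker`). Silverman, *AEC*, III.§4 (p. 66: an isogeny is a morphism over `K̄`;
"defined over `K`" = commuting with `G_{K̄/K}`, hence with `G_{K̄/L}`), I.§3, Ex. 1.12(c).
[cite: SilvermanAEC2009, III.§4 (Definition, p. 66) with I.§3 Ex. 1.12(c)] -/
def extendScalarsOfAlgEquiv (ι : AlgebraicClosure K ≃ₐ[K] AlgebraicClosure L) (φ : Isogeny W W') :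
    Isogeny (W.baseChange L) (W'.baseChange L) where
  toAddMonoidHom := ((W'.geomPointsExtend L ι).toAddMonoidHom.comp φ.toAddMonoidHom).comp
    (W.geomPointsExtend L ι).symm.toAddMonoidHom
  isAlgebraic := isAlgebraicOn_congr_of_algEquiv ι (W.geomPointsExtend L ι) (fun _ ↦ rfl)
    (W'.geomPointsExtend L ι) (fun _ ↦ rfl) φ.isAlgebraic
  equivariant σ Q := by
    obtain ⟨P, rfl⟩ := (W.geomPointsExtend L ι).surjective Q
    rw [← geomPointsExtend_smul]
    change W'.geomPointsExtend L ι (φ ((W.geomPointsExtend L ι).symm (W.geomPointsExtend L ι _))) =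
      σ • W'.geomPointsExtend L ι (φ ((W.geomPointsExtend L ι).symm (W.geomPointsExtend L ι P)))
    rw [AddEquiv.symm_apply_apply, AddEquiv.symm_apply_apply, φ.map_smul, geomPointsExtend_smul]
  finite_ker := IsAlgebraicOn.finite_ker
    (isAlgebraicOn_congr_of_algEquiv ι (W.geomPointsExtend L ι) (fun _ ↦ rfl)
      (W'.geomPointsExtend L ι) (fun _ ↦ rfl) φ.isAlgebraic)

/-- The extended isogeny is `ι_* ∘ φ ∘ ι_*⁻¹` on points. [folklore] -/
private theorem extendScalarsOfAlgEquiv_apply (ι : AlgebraicClosure K ≃ₐ[K] AlgebraicClosure L)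
    (φ : Isogeny W W') (Q : (W.baseChange L).geomPoints) :
    φ.extendScalarsOfAlgEquiv ι Q =
      W'.geomPointsExtend L ι (φ ((W.geomPointsExtend L ι).symm Q)) :=
  rfl

/-- **`φ_L` extends `φ`**: `φ_L (ι_* P) = ι_* (φ P)` — the isogeny over `L` and the isogeny over
`K` are the same morphism on `K̄ = L̄`-points (Silverman, *AEC*, III.§4: isogenies are morphisms
over `K̄`). [cite: SilvermanAEC2009, III.§4 (Definition, p. 66) with I.§3 Ex. 1.12(c)] -/
theorem extendScalarsOfAlgEquiv_apply_geomPointsExtend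
    (ι : AlgebraicClosure K ≃ₐ[K] AlgebraicClosure L) (φ : Isogeny W W') (P : W.geomPoints) :
    φ.extendScalarsOfAlgEquiv ι (W.geomPointsExtend L ι P) = W'.geomPointsExtend L ι (φ P) := by
  rw [extendScalarsOfAlgEquiv_apply, AddEquiv.symm_apply_apply]

/-- The kernel of `φ_L` is `ι_*` of the kernel of `φ`, so it has the same cardinality; in
characteristic `0` this says `deg φ_L = deg φ` for the tree's `Isogeny.degree = #ker`.
Silverman, *AEC*, III.§4. [folklore] -/
private theorem natCard_ker_extendScalarsOfAlgEquiv (ι : AlgebraicClosure K ≃ₐ[K] AlgebraicClosure L)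
    (φ : Isogeny W W') :
    Nat.card (φ.extendScalarsOfAlgEquiv ι).toAddMonoidHom.ker = Nat.card φ.toAddMonoidHom.ker := by
  refine Nat.card_congr
    (Equiv.subtypeEquiv (W.geomPointsExtend L ι).symm.toEquiv fun Q ↦ ?_)
  change W'.geomPointsExtend L ι (φ ((W.geomPointsExtend L ι).symm Q)) = 0 ↔
    φ ((W.geomPointsExtend L ι).symm Q) = 0
  rw [AddEquiv.map_eq_zero_iff]

/-- **`deg φ_L = deg φ`** (the tree's `Isogeny.degree`, the order of the kernel on geometric
points): the degree of an isogeny is defined over `K̄` and does not depend on the field of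
definition. Silverman, *AEC*, III.§4 (degree of an isogeny, p. 66; Thm. III.4.10(a)).
[cite: SilvermanAEC2009, III.§4 (p. 66) and Thm. III.4.10(a)] -/
theorem degree_extendScalarsOfAlgEquiv (ι : AlgebraicClosure K ≃ₐ[K] AlgebraicClosure L)
    (φ : Isogeny W W') : (φ.extendScalarsOfAlgEquiv ι).degree = φ.degree :=
  natCard_ker_extendScalarsOfAlgEquiv ι φ

/-- **Extension of the ground field of an isogeny** to an ALGEBRAIC extension `L/K`, along the
tree's chosen `K`-isomorphism `absClosureEquiv K L : K̄ ≃ₐ[K] L̄`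
(`Literature.NumberTheory.GaloisRepresentations`, Milne, *Fields and Galois Theory*, §7).
Silverman, *AEC*, III.§4 with I.§3 Ex. 1.12(c).
[cite: SilvermanAEC2009, III.§4 (Definition, p. 66) with I.§3 Ex. 1.12(c)] -/
def extendScalars (L : Type u) [Field L] [Algebra K L] [Algebra.IsAlgebraic K L]
    (φ : Isogeny W W') : Isogeny (W.baseChange L) (W'.baseChange L) :=
  φ.extendScalarsOfAlgEquiv (absClosureEquiv K L)

/-- **`deg φ_L = deg φ`** for `extendScalars`: the degree of an isogeny does not depend on the
field of definition. Silverman, *AEC*, III.§4 (p. 66; Thm. III.4.10(a)).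
[cite: SilvermanAEC2009, III.§4 (p. 66) and Thm. III.4.10(a)] -/
theorem degree_extendScalars (L : Type u) [Field L] [Algebra K L] [Algebra.IsAlgebraic K L]
    (φ : Isogeny W W') : (φ.extendScalars L).degree = φ.degree :=
  degree_extendScalarsOfAlgEquiv _ φ

end Isogeny

/-! ## Isogenous curves stay isogenous over extensions -/

variable {W W' L} in
/-- **`W ∼_K W' ⟹ W_L ∼_L W'_L` along a given `ι : K̄ ≃ₐ[K] L̄`.** Silverman, *AEC*, III.§4.
[cite: SilvermanAEC2009, III.§4 (Definition, p. 66) with I.§3 Ex. 1.12(c)] -/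
theorem IsIsogenous.extendScalarsOfAlgEquiv (ι : AlgebraicClosure K ≃ₐ[K] AlgebraicClosure L)
    (h : IsIsogenous W W') : IsIsogenous (W.baseChange L) (W'.baseChange L) :=
  h.elim fun φ ↦ ⟨φ.extendScalarsOfAlgEquiv ι⟩

variable {W W'} in
/-- **Isogenous curves stay isogenous over every algebraic extension of the ground field**: if
`W ∼ W'` over `K` and `L/K` is algebraic (e.g. a finite extension of number fields), then
`W.baseChange L ∼ W'.baseChange L` over `L`. Silverman, *AEC*, III.§4 (an isogeny defined over `K`
is defined over `L`), with Milne, *Fields and Galois Theory*, §7 for `K̄ ≃_K L̄`.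
[cite: SilvermanAEC2009, III.§4 (Definition, p. 66) with I.§3 Ex. 1.12(c)] -/
theorem IsIsogenous.extendScalars [Algebra.IsAlgebraic K L] (h : IsIsogenous W W') :
    IsIsogenous (W.baseChange L) (W'.baseChange L) :=
  h.extendScalarsOfAlgEquiv (absClosureEquiv K L)

end WeierstrassCurve

end
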